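import Literature.AlgebraicGeometry.Motives.MixedHodgeStructureCatDualFunctor
import Literature.AlgebraicGeometry.Motives.MixedHodgeStructureCatHodgeClasses
import Literature.AlgebraicGeometry.Motives.MixedHodgeStructureInternalHomEvaluation
import Literature.AlgebraicGeometry.Motives.MixedHodgeStructureInternalHomMorphisms
import Literature.AlgebraicGeometry.Motives.MixedHodgeStructureInternalHomFiltrations
import Literature.AlgebraicGeometry.Motives.MixedHodgeStructureTensorMorphisms
import Mathlib.CategoryTheory.Adjunction.Basic
import HarnessLib

/-!
# The internal Hom of `MixedHodgeStructureCat`: `− ⊗ X ⊣ Hom(X, −)` on finite-dimensional objects, and `Hom(X, Y) = Hdg⁰ Hom(X, Y)`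

Layer `Literature/AlgebraicGeometry/Motives` (lane `lit-hodgefound`).  The tree's unbundled tensor product `H₁ ⊗ H₂` (`Motives/MixedHodgeStructureTensor`,
`Hom.tensorMap`), internal Hom `Hom(H₁, H₂)` (`Motives/MixedHodgeStructureInternalHom`, Deligne's `H₁^∨ ⊗ H₂`; `Hom.homMap` functoriality,
`…InternalHomMorphisms`), the currying bijection `Hom(K ⊗ H₁, H₂) ≃ Hom(K, Hom(H₁, H₂))` with its evaluation (`tensorHomEquiv`, `curryHom`,
`uncurryHom`, `homEval`; `…InternalHomEvaluation`, Deligne–Milne Def. 1.6) and «morphisms = Hodge classes of type `(0,0)` of the internal Hom»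
(`homEquivHodgeClasses`, `…InternalHomFiltrations`, Deligne 1.1.12 ∕ 2.1.11.1) are assembled here CATEGORICALLY, on the full subcategory
`FinSubcategory` of finite-dimensional objects of `MixedHodgeStructureCat` (g45-#10):

* §1 the ambient objects `tensorObj X Y`, `ihomObj X Y` and morphisms `tensorHom f g`, `ihomMap f g` (bifunctoriality), `curry`, `uncurry`,
  `evalHom`, with the naturality of currying in both variables (`uncurry_comp`, `curry_comp`) and the `ℚ`-LINEAR currying isomorphism
  **`curryLinearEquiv K X Y : (K ⊗ X ⟶ Y) ≃ₗ[ℚ] (K ⟶ Hom(X, Y))`**;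
* §2 on `FinSubcategory`: the functors **`tensorRight X` (`K ↦ K ⊗ X`)** and **`ihom X` (`Y ↦ Hom(X, Y)`)** and the ADJUNCTION
  **`tensorIhomAdj X : tensorRight X ⊣ ihom X`** (Mathlib `Adjunction.mkOfHomEquiv`), whose counit is the evaluation `Hom(X, Y) ⊗ X ⟶ Y`;
  hence `ihom X` is a right adjoint (preserves limits) and `tensorRight X` a left adjoint;
* §3 **`Hom_MHS(X, Y) ≃ₗ[ℚ] Hdg⁰(Hom(X, Y))`** (`homLinearEquivHodgeClasses`), its twisted form `Hom(X, Y(r)) ≃ₗ Hdgʳ(Hom(X, Y))`, and with the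
  corepresentability of Hodge classes by the Tate object (g43-#11 `homTateLinearEquiv`) **`Hom(X, Y) ≃ₗ[ℚ] Hom(ℚ(0), Hom(X, Y))`**
  (Deligne–Milne (1.6.4)).

Everything is PROVED; no named fact, no instance (adjointness properties as theorems), no notation.  Data: the objects ∕ morphisms ∕ functors ∕
equivalences ∕ adjunction listed.

Sources, verbatim (through the tree's files).  P. Deligne, *Théorie de Hodge II*, Publ. Math. IHÉS 40 (1971) [DeligneHodgeII1971], 1.1.12 (`Hom` and `⊗` of
filtered objects; «On a donc `Hom((A, F), (B, F)) = F⁰(Hom(A, B))`»), 2.1.11.1.  P. Deligne, J. S. Milne, *Tannakian categories*, LNM 900 (1982)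
[DeligneMilne1982Tannakian], §1 Def. 1.6 (internal Hom: `Hom(T, Hom(X, Y)) = Hom(T ⊗ X, Y)` functorially in `T`; `ev_{X,Y} : Hom(X, Y) ⊗ X → Y`
corresponds to the identity), (1.6.3), (1.6.4) `Hom(1, Hom(X, Y)) = Hom(X, Y)`.  E. Cattani et al. (eds.), *Hodge Theory* (2014)
[CattaniElZeinGriffithsLe2014], §3.2.2.7 (tensor product, internal Hom, dual of MHS), Ch. 3 §3.1.1.3 Remark p. 132 (morphisms of type `(r, r)`).

## Main results

* §1 `tensorObj`, `tensorHom`, `tensorHom_toLinearMap_apply_tmul`, `tensorHom_id`, `tensorHom_comp`, `finite_tensorObj`, `ihomObj`, `ihomMap`,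
  `ihomMap_toLinearMap_apply`, `ihomMap_id`, `ihomMap_comp`, `finite_ihomObj`, `curry`, `uncurry`, `curry_toLinearMap_apply`,
  `uncurry_toLinearMap_apply_tmul`, `uncurry_curry`, `curry_uncurry`, `evalHom`, `evalHom_toLinearMap_apply_tmul`, `uncurry_id`,
  **`uncurry_comp`**, **`curry_comp`**, `uncurry_eq_tensorHom_comp_evalHom`, **`curryLinearEquiv`** (`_apply`, `_symm_apply`).
* §2 `finTensorObj`, **`tensorRight`** (`_obj`, `_map_hom`), `finIhomObj`, **`ihom`** (`_obj`, `_map_hom`), `finCurryEquiv`, **`tensorIhomAdj`**,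
  `tensorIhomAdj_homEquiv`, `tensorIhomAdj_counit_app_hom`, `ihom_isRightAdjoint`, `tensorRight_isLeftAdjoint`.
* §3 **`homLinearEquivHodgeClasses`** (`_apply`), `homTateTwistLinearEquivHodgeClasses` (`_apply`), **`homLinearEquivTateHom`**.

## References

* [DeligneHodgeII1971] P. Deligne, Théorie de Hodge II, Publ. Math. IHÉS 40 (1971), 1.1.12, 2.1.11.1, 2.3.1.
* [DeligneMilne1982Tannakian] P. Deligne, J. S. Milne, Tannakian categories, in LNM 900 (1982), §1 Def. 1.6, (1.6.3), (1.6.4).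
* [CattaniElZeinGriffithsLe2014] E. Cattani et al. (eds.), Hodge Theory, Princeton Math. Notes 49 (2014), §3.2.2.7, Ch. 3 §3.1.1.3 Remark p. 132.

## Provenance

Lane `lit-hodgefound` (summit `HodgeConjecture`), seat `lit-hodgefound-p36` (literature-prover, generation 45, row g45-#13).
-/

noncomputable section

open CategoryTheory CategoryTheory.Limits
open scoped TensorProduct

namespace Literature.AlgebraicGeometry.Motives

universe u

namespace MixedHodgeStructureCat

/-! ## §1 Tensor and internal Hom objects, currying, in the ambient category -/

section Ambient

variable {K K' X X' X'' Y Y' Y'' : MixedHodgeStructureCat.{u}} [Module.Finite ℚ K] [Module.Finite ℚ K'] [Module.Finite ℚ X] [Module.Finite ℚ X']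
  [Module.Finite ℚ X''] [Module.Finite ℚ Y] [Module.Finite ℚ Y'] [Module.Finite ℚ Y'']

variable (X Y) in
/-- **The tensor product object `X ⊗ Y`** (the tree's `MixedHodgeStructure.tensor` on `X ⊗_ℚ Y`). [cite: DeligneHodgeII1971, 1.1.12]
[cite: CattaniElZeinGriffithsLe2014, §3.2.2.7] -/
abbrev tensorObj : MixedHodgeStructureCat.{u} := of (X.str.tensor Y.str)

variable (X Y) in
/-- `X ⊗ Y` is finite-dimensional. [cite: CattaniElZeinGriffithsLe2014, §3.2.2.7] -/
theorem finite_tensorObj : Module.Finite ℚ (tensorObj X Y) := inferInstanceAs (Module.Finite ℚ (X ⊗[ℚ] Y))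

/-- **`f ⊗ g : X ⊗ Y ⟶ X' ⊗ Y'`** (the tree's `Hom.tensorMap`). [cite: DeligneHodgeII1971, 1.1.12] -/
abbrev tensorHom (f : X ⟶ X') (g : Y ⟶ Y') : tensorObj X Y ⟶ tensorObj X' Y' := MixedHodgeStructure.Hom.tensorMap f g

/-- `(f ⊗ g)(x ⊗ y) = f x ⊗ g y`. [cite: DeligneHodgeII1971, 1.1.12] -/
theorem tensorHom_toLinearMap_apply_tmul (f : X ⟶ X') (g : Y ⟶ Y') (x : X) (y : Y) :
    (tensorHom f g).toLinearMap (x ⊗ₜ[ℚ] y) = f.toLinearMap x ⊗ₜ[ℚ] g.toLinearMap y := rfl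

variable (X Y) in
/-- `𝟙 ⊗ 𝟙 = 𝟙`. [cite: DeligneHodgeII1971, 1.1.12] -/
theorem tensorHom_id : tensorHom (𝟙 X) (𝟙 Y) = 𝟙 (tensorObj X Y) := MixedHodgeStructure.Hom.tensorMap_id X.str Y.str

/-- `(f ≫ f') ⊗ (g ≫ g') = (f ⊗ g) ≫ (f' ⊗ g')`: `⊗` is a bifunctor. [cite: DeligneHodgeII1971, 1.1.12] -/
theorem tensorHom_comp (f : X ⟶ X') (f' : X' ⟶ X'') (g : Y ⟶ Y') (g' : Y' ⟶ Y'') :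
    tensorHom (f ≫ f') (g ≫ g') = tensorHom f g ≫ tensorHom f' g' :=
  MixedHodgeStructure.Hom.tensorMap_comp f' f g' g

variable (X Y) in
/-- **The internal Hom object `Hom(X, Y)`** (the tree's `MixedHodgeStructure.hom` on `X →ₗ[ℚ] Y`, Deligne's `X^∨ ⊗ Y`). [cite: DeligneHodgeII1971, 1.1.12]
[cite: CattaniElZeinGriffithsLe2014, §3.2.2.7] -/
abbrev ihomObj : MixedHodgeStructureCat.{u} := of (MixedHodgeStructure.hom X.str Y.str)

variable (X Y) in
/-- `Hom(X, Y)` is finite-dimensional. [cite: CattaniElZeinGriffithsLe2014, §3.2.2.7] -/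
theorem finite_ihomObj : Module.Finite ℚ (ihomObj X Y) := inferInstanceAs (Module.Finite ℚ (X →ₗ[ℚ] Y))

/-- **`Hom(f, g) : Hom(X, Y) ⟶ Hom(X', Y')`, `φ ↦ g ∘ φ ∘ f`** for `f : X' ⟶ X`, `g : Y ⟶ Y'` (the tree's `Hom.homMap`). [cite: DeligneHodgeII1971, 1.1.12] -/
abbrev ihomMap (f : X' ⟶ X) (g : Y ⟶ Y') : ihomObj X Y ⟶ ihomObj X' Y' := MixedHodgeStructure.Hom.homMap f g

/-- `Hom(f, g) φ = g ∘ φ ∘ f`. [cite: DeligneHodgeII1971, 1.1.12] -/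
theorem ihomMap_toLinearMap_apply (f : X' ⟶ X) (g : Y ⟶ Y') (φ : X →ₗ[ℚ] Y) :
    (ihomMap f g).toLinearMap φ = g.toLinearMap ∘ₗ φ ∘ₗ f.toLinearMap :=
  MixedHodgeStructure.Hom.homMap_toLinearMap_apply f g φ

variable (X Y) in
/-- `Hom(𝟙, 𝟙) = 𝟙`. [cite: DeligneHodgeII1971, 1.1.12] -/
theorem ihomMap_id : ihomMap (𝟙 X) (𝟙 Y) = 𝟙 (ihomObj X Y) := MixedHodgeStructure.Hom.homMap_id X.str Y.str

/-- `Hom(f' ≫ f, g ≫ g') = Hom(f, g) ≫ Hom(f', g')`: `Hom(−, −)` is a bifunctor, contravariant in the first variable. [cite: DeligneHodgeII1971, 1.1.12] -/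
theorem ihomMap_comp (f : X' ⟶ X) (f' : X'' ⟶ X') (g : Y ⟶ Y') (g' : Y' ⟶ Y'') :
    ihomMap (f' ≫ f) (g ≫ g') = ihomMap f g ≫ ihomMap f' g' :=
  MixedHodgeStructure.Hom.homMap_comp f f' g g'

/-- **Currying** `(K ⊗ X ⟶ Y) → (K ⟶ Hom(X, Y))`, `g ↦ (k ↦ (x ↦ g(k ⊗ x)))` (the tree's `curryHom`). [cite: DeligneMilne1982Tannakian, §1 Def. 1.6] -/
abbrev curry (g : tensorObj K X ⟶ Y) : K ⟶ ihomObj X Y := MixedHodgeStructure.curryHom X.str Y.str g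

/-- **Uncurrying** `(K ⟶ Hom(X, Y)) → (K ⊗ X ⟶ Y)`, `f ↦ (k ⊗ x ↦ f(k)(x))` (the tree's `uncurryHom`). [cite: DeligneMilne1982Tannakian, §1 Def. 1.6] -/
abbrev uncurry (f : K ⟶ ihomObj X Y) : tensorObj K X ⟶ Y := MixedHodgeStructure.uncurryHom X.str Y.str f

/-- `(curry g) k x = g (k ⊗ x)`. [cite: DeligneMilne1982Tannakian, §1 Def. 1.6] -/
theorem curry_toLinearMap_apply (g : tensorObj K X ⟶ Y) (k : K) (x : X) : (curry g).toLinearMap k x = g.toLinearMap (k ⊗ₜ[ℚ] x) := rfl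

/-- `(uncurry f) (k ⊗ x) = f k x`. [cite: DeligneMilne1982Tannakian, §1 Def. 1.6] -/
theorem uncurry_toLinearMap_apply_tmul (f : K ⟶ ihomObj X Y) (k : K) (x : X) : (uncurry f).toLinearMap (k ⊗ₜ[ℚ] x) = f.toLinearMap k x := rfl

/-- `uncurry (curry g) = g`. [cite: DeligneMilne1982Tannakian, §1 Def. 1.6] -/
theorem uncurry_curry (g : tensorObj K X ⟶ Y) : uncurry (curry g) = g := MixedHodgeStructure.uncurryHom_curryHom X.str Y.str g

/-- `curry (uncurry f) = f`. [cite: DeligneMilne1982Tannakian, §1 Def. 1.6] -/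
theorem curry_uncurry (f : K ⟶ ihomObj X Y) : curry (uncurry f) = f := MixedHodgeStructure.curryHom_uncurryHom X.str Y.str f

variable (X Y) in
/-- **The evaluation `ev : Hom(X, Y) ⊗ X ⟶ Y`**, `φ ⊗ x ↦ φ x` (the tree's `homEval`). [cite: DeligneMilne1982Tannakian, §1 Def. 1.6] -/
abbrev evalHom : tensorObj (ihomObj X Y) X ⟶ Y := MixedHodgeStructure.homEval X.str Y.str

/-- `ev (φ ⊗ x) = φ x`. [cite: DeligneMilne1982Tannakian, §1 Def. 1.6] -/
theorem evalHom_toLinearMap_apply_tmul (φ : X →ₗ[ℚ] Y) (x : X) : (evalHom X Y).toLinearMap (φ ⊗ₜ[ℚ] x) = φ x :=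
  MixedHodgeStructure.homEval_apply_tmul X.str Y.str φ x

variable (X Y) in
/-- `ev` is the uncurrying of `𝟙 Hom(X, Y)` («the morphism corresponding to `id_{Hom(X,Y)}`»). [cite: DeligneMilne1982Tannakian, §1 Def. 1.6] -/
theorem uncurry_id : uncurry (𝟙 (ihomObj X Y)) = evalHom X Y := MixedHodgeStructure.uncurryHom_id X.str Y.str

/-- **Naturality of uncurrying in `K`**: `uncurry (f ≫ g) = (f ⊗ 𝟙) ≫ uncurry g`. [cite: DeligneMilne1982Tannakian, §1 Def. 1.6 («functorially in T»)] -/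
theorem uncurry_comp (f : K' ⟶ K) (g : K ⟶ ihomObj X Y) : uncurry (f ≫ g) = tensorHom f (𝟙 X) ≫ uncurry g :=
  hom_ext (TensorProduct.ext' fun _ _ => rfl)

/-- **Naturality of currying in `Y`**: `curry (f ≫ g) = curry f ≫ Hom(𝟙, g)`. [cite: DeligneMilne1982Tannakian, §1 Def. 1.6 and (1.6.3)] -/
theorem curry_comp (f : tensorObj K X ⟶ Y) (g : Y ⟶ Y') : curry (f ≫ g) = curry f ≫ ihomMap (𝟙 X) g := by
  apply hom_ext
  refine LinearMap.ext fun k => LinearMap.ext fun x => ?_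
  rw [comp_toLinearMap, LinearMap.comp_apply, ihomMap_toLinearMap_apply]
  rfl

/-- `uncurry f = (f ⊗ 𝟙) ≫ ev` («to a `g` there corresponds a unique `f` such that `ev ∘ (f ⊗ id) = g`»). [cite: DeligneMilne1982Tannakian, §1 Def. 1.6] -/
theorem uncurry_eq_tensorHom_comp_evalHom (f : K ⟶ ihomObj X Y) : uncurry f = tensorHom f (𝟙 X) ≫ evalHom X Y := by
  rw [← uncurry_id, ← uncurry_comp, Category.comp_id]

variable (K X Y) in
/-- **`Hom_MHS(K ⊗ X, Y) ≃ₗ[ℚ] Hom_MHS(K, Hom(X, Y))`**, `ℚ`-linearly (currying). [cite: DeligneMilne1982Tannakian, §1 Def. 1.6 and (1.6.3)]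
[cite: DeligneHodgeII1971, 1.1.12] -/
def curryLinearEquiv : (tensorObj K X ⟶ Y) ≃ₗ[ℚ] (K ⟶ ihomObj X Y) where
  toFun := curry
  invFun := uncurry
  map_add' _ _ := hom_ext (LinearMap.ext fun _ => LinearMap.ext fun _ => rfl)
  map_smul' _ _ := hom_ext (LinearMap.ext fun _ => LinearMap.ext fun _ => rfl)
  left_inv := uncurry_curry
  right_inv := curry_uncurry

/-- Unfolding `curryLinearEquiv`. [cite: DeligneMilne1982Tannakian, §1 Def. 1.6] -/
theorem curryLinearEquiv_apply (g : tensorObj K X ⟶ Y) : curryLinearEquiv K X Y g = curry g := rfl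

/-- Unfolding `curryLinearEquiv.symm`. [cite: DeligneMilne1982Tannakian, §1 Def. 1.6] -/
theorem curryLinearEquiv_symm_apply (f : K ⟶ ihomObj X Y) : (curryLinearEquiv K X Y).symm f = uncurry f := rfl

end Ambient

/-! ## §2 `− ⊗ X ⊣ Hom(X, −)` on the finite-dimensional full subcategory -/

section Adjunction

/-- `K ⊗ X` in `FinSubcategory`. [cite: CattaniElZeinGriffithsLe2014, §3.2.2.7] -/
def finTensorObj (K X : FinSubcategory.{u}) : FinSubcategory.{u} :=
  haveI : Module.Finite ℚ K.obj := K.property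
  haveI : Module.Finite ℚ X.obj := X.property
  ⟨tensorObj K.obj X.obj, finite_tensorObj K.obj X.obj⟩

/-- `Hom(X, Y)` in `FinSubcategory`. [cite: CattaniElZeinGriffithsLe2014, §3.2.2.7] -/
def finIhomObj (X Y : FinSubcategory.{u}) : FinSubcategory.{u} :=
  haveI : Module.Finite ℚ X.obj := X.property
  haveI : Module.Finite ℚ Y.obj := Y.property
  ⟨ihomObj X.obj Y.obj, finite_ihomObj X.obj Y.obj⟩

/-- **The functor `− ⊗ X : K ↦ K ⊗ X`** on `FinSubcategory` (`f ↦ f ⊗ 𝟙`). [cite: DeligneHodgeII1971, 1.1.12] [cite: DeligneMilne1982Tannakian, §1 Def. 1.6] -/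
def tensorRight (X : FinSubcategory.{u}) : FinSubcategory.{u} ⥤ FinSubcategory.{u} where
  obj K := finTensorObj K X
  map {K K'} f :=
    haveI : Module.Finite ℚ K.obj := K.property
    haveI : Module.Finite ℚ K'.obj := K'.property
    haveI : Module.Finite ℚ X.obj := X.property
    ObjectProperty.homMk (tensorHom f.hom (𝟙 X.obj))
  map_id K := by
    apply isFinite.hom_ext
    haveI : Module.Finite ℚ K.obj := K.property
    haveI : Module.Finite ℚ X.obj := X.property
    exact tensorHom_id K.obj X.obj
  map_comp {K K' K''} f g := by
    apply isFinite.hom_ext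
    haveI : Module.Finite ℚ K.obj := K.property
    haveI : Module.Finite ℚ K'.obj := K'.property
    haveI : Module.Finite ℚ K''.obj := K''.property
    haveI : Module.Finite ℚ X.obj := X.property
    change tensorHom (f.hom ≫ g.hom) (𝟙 X.obj) = tensorHom f.hom (𝟙 X.obj) ≫ tensorHom g.hom (𝟙 X.obj)
    rw [← tensorHom_comp, Category.id_comp]

/-- Unfolding `tensorRight` on objects. [cite: DeligneHodgeII1971, 1.1.12] -/
theorem tensorRight_obj (X K : FinSubcategory.{u}) : (tensorRight X).obj K = finTensorObj K X := rfl

/-- Unfolding `tensorRight` on morphisms. [cite: DeligneHodgeII1971, 1.1.12] -/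
theorem tensorRight_map_hom (X : FinSubcategory.{u}) {K K' : FinSubcategory.{u}} (f : K ⟶ K') :
    ((tensorRight X).map f).hom =
      haveI : Module.Finite ℚ K.obj := K.property
      haveI : Module.Finite ℚ K'.obj := K'.property
      haveI : Module.Finite ℚ X.obj := X.property
      tensorHom f.hom (𝟙 X.obj) := rfl

/-- **The functor `Hom(X, −) : Y ↦ Hom(X, Y)`** on `FinSubcategory` (`g ↦ Hom(𝟙, g)`). [cite: DeligneHodgeII1971, 1.1.12] [cite: DeligneMilne1982Tannakian, §1 Def. 1.6] -/
def ihom (X : FinSubcategory.{u}) : FinSubcategory.{u} ⥤ FinSubcategory.{u} where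
  obj Y := finIhomObj X Y
  map {Y Y'} g :=
    haveI : Module.Finite ℚ Y.obj := Y.property
    haveI : Module.Finite ℚ Y'.obj := Y'.property
    haveI : Module.Finite ℚ X.obj := X.property
    ObjectProperty.homMk (ihomMap (𝟙 X.obj) g.hom)
  map_id Y := by
    apply isFinite.hom_ext
    haveI : Module.Finite ℚ Y.obj := Y.property
    haveI : Module.Finite ℚ X.obj := X.property
    exact ihomMap_id X.obj Y.obj
  map_comp {Y Y' Y''} g g' := by
    apply isFinite.hom_ext
    haveI : Module.Finite ℚ Y.obj := Y.property
    haveI : Module.Finite ℚ Y'.obj := Y'.property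
    haveI : Module.Finite ℚ Y''.obj := Y''.property
    haveI : Module.Finite ℚ X.obj := X.property
    change ihomMap (𝟙 X.obj) (g.hom ≫ g'.hom) = ihomMap (𝟙 X.obj) g.hom ≫ ihomMap (𝟙 X.obj) g'.hom
    rw [← ihomMap_comp, Category.id_comp]

/-- Unfolding `ihom` on objects. [cite: DeligneHodgeII1971, 1.1.12] -/
theorem ihom_obj (X Y : FinSubcategory.{u}) : (ihom X).obj Y = finIhomObj X Y := rfl

/-- Unfolding `ihom` on morphisms. [cite: DeligneHodgeII1971, 1.1.12] -/
theorem ihom_map_hom (X : FinSubcategory.{u}) {Y Y' : FinSubcategory.{u}} (g : Y ⟶ Y') :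
    ((ihom X).map g).hom =
      haveI : Module.Finite ℚ Y.obj := Y.property
      haveI : Module.Finite ℚ Y'.obj := Y'.property
      haveI : Module.Finite ℚ X.obj := X.property
      ihomMap (𝟙 X.obj) g.hom := rfl

/-- The currying bijection `((− ⊗ X) K ⟶ Y) ≃ (K ⟶ Hom(X, −) Y)` in `FinSubcategory`. [cite: DeligneMilne1982Tannakian, §1 Def. 1.6] -/
def finCurryEquiv (K X Y : FinSubcategory.{u}) : ((tensorRight X).obj K ⟶ Y) ≃ (K ⟶ (ihom X).obj Y) :=
  haveI : Module.Finite ℚ K.obj := K.property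
  haveI : Module.Finite ℚ X.obj := X.property
  haveI : Module.Finite ℚ Y.obj := Y.property
  { toFun := fun g => ObjectProperty.homMk (curry g.hom)
    invFun := fun f => ObjectProperty.homMk (uncurry f.hom)
    left_inv := fun g => isFinite.hom_ext (uncurry_curry g.hom)
    right_inv := fun f => isFinite.hom_ext (curry_uncurry f.hom) }

/-- **The tensor–Hom adjunction `− ⊗ X ⊣ Hom(X, −)` on finite-dimensional mixed Hodge structures** («the functor `T ↦ Hom(T ⊗ X, Y)` is represented
by `Hom(X, Y)`», functorially). [cite: DeligneMilne1982Tannakian, §1 Def. 1.6 and (1.6.3)] [cite: DeligneHodgeII1971, 1.1.12] -/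
def tensorIhomAdj (X : FinSubcategory.{u}) : tensorRight X ⊣ ihom X :=
  Adjunction.mkOfHomEquiv
    { homEquiv := fun K Y => finCurryEquiv K X Y
      homEquiv_naturality_left_symm := fun {K' K Y} f g => by
        apply isFinite.hom_ext
        haveI : Module.Finite ℚ K.obj := K.property
        haveI : Module.Finite ℚ K'.obj := K'.property
        haveI : Module.Finite ℚ X.obj := X.property
        haveI : Module.Finite ℚ Y.obj := Y.property
        change uncurry (f.hom ≫ g.hom) = tensorHom f.hom (𝟙 X.obj) ≫ uncurry g.hom
        exact uncurry_comp f.hom g.hom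
      homEquiv_naturality_right := fun {K Y Y'} f g => by
        apply isFinite.hom_ext
        haveI : Module.Finite ℚ K.obj := K.property
        haveI : Module.Finite ℚ X.obj := X.property
        haveI : Module.Finite ℚ Y.obj := Y.property
        haveI : Module.Finite ℚ Y'.obj := Y'.property
        change curry (f.hom ≫ g.hom) = curry f.hom ≫ ihomMap (𝟙 X.obj) g.hom
        exact curry_comp f.hom g.hom }

/-- The hom-set bijection of `tensorIhomAdj X` is currying. [cite: DeligneMilne1982Tannakian, §1 Def. 1.6] -/
theorem tensorIhomAdj_homEquiv (X K Y : FinSubcategory.{u}) : (tensorIhomAdj X).homEquiv K Y = finCurryEquiv K X Y := by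
  rw [tensorIhomAdj, Adjunction.mkOfHomEquiv_homEquiv]

/-- **The counit of `− ⊗ X ⊣ Hom(X, −)` at `Y` is the evaluation `Hom(X, Y) ⊗ X ⟶ Y`.** [cite: DeligneMilne1982Tannakian, §1 Def. 1.6] -/
theorem tensorIhomAdj_counit_app_hom (X Y : FinSubcategory.{u}) :
    ((tensorIhomAdj X).counit.app Y).hom =
      haveI : Module.Finite ℚ X.obj := X.property
      haveI : Module.Finite ℚ Y.obj := Y.property
      evalHom X.obj Y.obj := by
  haveI : Module.Finite ℚ X.obj := X.property
  haveI : Module.Finite ℚ Y.obj := Y.property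
  rw [tensorIhomAdj, Adjunction.mkOfHomEquiv_counit_app]
  exact uncurry_id X.obj Y.obj

/-- `Hom(X, −)` is a right adjoint (hence preserves all limits). [cite: DeligneMilne1982Tannakian, §1 Def. 1.6] -/
theorem ihom_isRightAdjoint (X : FinSubcategory.{u}) : (ihom X).IsRightAdjoint := ⟨_, ⟨tensorIhomAdj X⟩⟩

/-- `− ⊗ X` is a left adjoint (hence preserves all colimits). [cite: DeligneMilne1982Tannakian, §1 Def. 1.6] -/
theorem tensorRight_isLeftAdjoint (X : FinSubcategory.{u}) : (tensorRight X).IsLeftAdjoint := ⟨_, ⟨tensorIhomAdj X⟩⟩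

end Adjunction

/-! ## §3 Morphisms as Hodge classes of the internal Hom -/

section HodgeClasses

variable (X Y : MixedHodgeStructureCat.{u}) [Module.Finite ℚ X] [Module.Finite ℚ Y]

/-- **`Hom_MHS(X, Y) ≃ₗ[ℚ] Hdg⁰(Hom(X, Y))`**, `φ ↦ φ` (its underlying linear map): morphisms of MHS are the rational `(0,0)`-classes of the internal
Hom (the tree's `homEquivHodgeClasses`, made `ℚ`-linear). [cite: DeligneHodgeII1971, 1.1.12 and 2.1.11.1] [cite: CattaniElZeinGriffithsLe2014, Ch. 3 §3.1.1.3 Remark p. 132] -/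
def homLinearEquivHodgeClasses : (X ⟶ Y) ≃ₗ[ℚ] (MixedHodgeStructure.hom X.str Y.str).hodgeClasses 0 :=
  { MixedHodgeStructure.homEquivHodgeClasses X.str Y.str with
    map_add' := fun _ _ => rfl
    map_smul' := fun _ _ => rfl }

/-- Unfolding `homLinearEquivHodgeClasses`. [cite: DeligneHodgeII1971, 1.1.12 and 2.1.11.1] -/
theorem coe_homLinearEquivHodgeClasses_apply (φ : X ⟶ Y) : (homLinearEquivHodgeClasses X Y φ : X →ₗ[ℚ] Y) = φ.toLinearMap := rfl

/-- **`Hom_MHS(X, Y(r)) ≃ₗ[ℚ] Hdgʳ(Hom(X, Y))`**: morphisms of type `(r, r)` are the rational `(r, r)`-classes of the internal Hom (the tree's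
`homTateTwistEquivHodgeClasses`, made `ℚ`-linear). [cite: DeligneHodgeII1971, 1.1.12 and 2.1.11.1] [cite: CattaniElZeinGriffithsLe2014, Ch. 3 §3.1.1.3 Remark p. 132] -/
def homTateTwistLinearEquivHodgeClasses (r : ℤ) : (X ⟶ (tateTwist r).obj Y) ≃ₗ[ℚ] (MixedHodgeStructure.hom X.str Y.str).hodgeClasses r :=
  { MixedHodgeStructure.homTateTwistEquivHodgeClasses X.str Y.str r with
    map_add' := fun _ _ => rfl
    map_smul' := fun _ _ => rfl }

/-- Unfolding `homTateTwistLinearEquivHodgeClasses`. [cite: DeligneHodgeII1971, 1.1.12 and 2.1.11.1] -/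
theorem coe_homTateTwistLinearEquivHodgeClasses_apply (r : ℤ) (φ : X ⟶ (tateTwist r).obj Y) :
    (homTateTwistLinearEquivHodgeClasses X Y r φ : X →ₗ[ℚ] Y) = φ.toLinearMap := rfl

/-- **`Hom_MHS(X, Y) ≃ₗ[ℚ] Hom_MHS(ℚ(0), Hom(X, Y))`** (Deligne–Milne (1.6.4) `Hom(1, Hom(X, Y)) = Hom(X, Y)`): through `Hdg⁰(Hom(X, Y))` and the
corepresentability of Hodge classes by the Tate object `ℚ(0)` (g43-#11 `homTateLinearEquiv`). [cite: DeligneMilne1982Tannakian, §1 (1.6.4)]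
[cite: DeligneHodgeII1971, 1.1.12 and 2.1.11.1] -/
def homLinearEquivTateHom : (X ⟶ Y) ≃ₗ[ℚ] (tateObj.{u} 0 ⟶ ihomObj X Y) :=
  (homLinearEquivHodgeClasses X Y).trans (homTateLinearEquiv 0 (ihomObj X Y)).symm

end HodgeClasses

end MixedHodgeStructureCat

end Literature.AlgebraicGeometry.Motives
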